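import Summits.Ventures.HSemireg.WedgeHankelRecurrenceGaussChebyshevLevelSetUniformReal

/-!
# Venture HSemireg — **THE UNIFORM REAL FACTORISATIONS OF `T_n ∓ 1`: `2(T_n − 1) = 2ⁿ ∏_{j<n} (X − cos(2πj∕n))`, `2(T_n + 1) = 2ⁿ ∏_{j<n} (X − cos((2j+1)π∕n))`, i.e.
# `T_n − 1 = 2^{n−1} ∏ (X − cos(2πj∕n))`, `T_n + 1 = 2^{n−1} ∏ (X − cos((2j+1)π∕n))`, and the root multisets `(T_n − 1).roots = {cos(2πj∕n) : j < n}`, `(T_n + 1).roots = {cos((2j+1)π∕n) : j < n}`**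
# (`n ≥ 1`; no parity split — the alternation points `cos(jπ∕n)`, `0 < j < n`, are listed twice) — by the dilation `C_n(2x) = 2T_n(x)` from N508

HONEST FRAMING. Part of the Lean index of the computation cell `pub-hsemireg` (seat p10 gen 49, Sunday typer «UNIFORM-IN-n»).  Real polynomial algebra only (Mathlib `Polynomial.Chebyshev.T ∕ C`,
`Polynomial.comp`, `Polynomial.roots`); no variety, no cohomology theory, no sheaf, no Ext group and no semiregularity map is constructed here; nothing here says that HC / HC_CM / HC_AV holds; no
Literature fact (unproved `Prop`) is declared or used.  Custodian versions as in `WedgeHankelSiegelIdeal` (1/3).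
SOURCES (cited).  T. J. Rivlin, *The Chebyshev Polynomials* (1974), §1.2 (`T_n(x) ∓ 1` and the alternation points) and Ex. 1.5.x; J. C. Mason, D. C. Handscomb, *Chebyshev Polynomials* (2003), §2.2;
A. Erdélyi et al., *Higher Transcendental Functions* II (1953), §10.11 (product forms).
PROOF TYPED HERE.  Compose N508 `chebyshevC_sub_two_eq_prod_cos_real ∕ chebyshevC_add_two_eq_prod_cos_real` with `2X` (Mathlib `Polynomial.Chebyshev.C_comp_two_mul_X : C_n(2X) = 2T_n`,
`Polynomial.prod_comp`): each factor becomes `2X − 2cos θ = 2(X − cos θ)`; cancel one factor `2` in `ℝ[X]` for the `2^{n−1}` forms; roots by `roots_C_mul`, `roots_multiset_prod_X_sub_C`.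
DEDUP DISCLOSURE (`rg -n 'T_sub_one_eq_prod|T_add_one_eq_prod|sub_one_roots_real' Summits/Ventures/HSemireg`, `lean search`, 2026-09-04): N504 gives the parity-split multisets and N505 the
multiplicities; N332-type leaves factor `T_{n+1}` itself at its zeros; the uniform level-set products below are not in the tree; 0 hits for the 6 names below.

WHAT IS IN THE TREE.  N508; Mathlib `C_comp_two_mul_X`, `prod_comp`, `roots_C_mul`, `roots_multiset_prod_X_sub_C`.
THIS FILE (namespace `Summit.Ventures.HSemireg.Wedge.HankelOuter` continued; CHAINED on N508; 0 definitions):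
* §1274 **`two_mul_chebyshevT_sub_one_eq_prod_cos_real`**, **`chebyshevT_sub_one_eq_prod_cos_real`** (`2^{n−1}` form), **`chebyshevT_sub_one_roots_real`**,
  **`two_mul_chebyshevT_add_one_eq_prod_cos_real`**, **`chebyshevT_add_one_eq_prod_cos_real`**, **`chebyshevT_add_one_roots_real`**.
CAVEATS.  `n ≥ 1` (the `2^{n−1}` forms use `n − 1` in `ℕ` under the hypothesis `n ≠ 0`).  Nothing Ext-side.  New names only.
-/

open Module Polynomial
open scoped Matrix Polynomial

namespace Summit.Ventures.HSemireg.Wedge.HankelOuter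

/-! ## §1274. `T_n ∓ 1 = 2^{n−1} ∏_{j<n} (X − cos(…))` uniformly -/

/-- **`2(T_n − 1) = 2ⁿ ∏_{j<n} (X − cos(2πj∕n))` in `ℝ[X]`** (`n ≥ 1`). [Rivlin §1.2; this file, §1274] -/
theorem two_mul_chebyshevT_sub_one_eq_prod_cos_real {n : ℕ} (hn : n ≠ 0) :
    2 * (Polynomial.Chebyshev.T ℝ (n : ℤ) - 1) = Polynomial.C ((2 : ℝ) ^ n) * ∏ j ∈ Finset.range n, (Polynomial.X - Polynomial.C (Real.cos (j * (2 * Real.pi / n)))) := by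
  have h := congrArg (fun p : ℝ[X] => p.comp (2 * Polynomial.X)) (chebyshevC_sub_two_eq_prod_cos_real hn)
  simp only [sub_comp, Polynomial.Chebyshev.C_comp_two_mul_X, Polynomial.prod_comp, X_comp, C_comp] at h
  rw [show (2 : ℝ[X]).comp (2 * Polynomial.X) = 2 by rw [← Polynomial.C_ofNat, C_comp], ← mul_sub_one] at h
  rw [h, show (Polynomial.C ((2 : ℝ) ^ n)) = ∏ _j ∈ Finset.range n, Polynomial.C (2 : ℝ) by rw [Finset.prod_const, Finset.card_range, map_pow], ← Finset.prod_mul_distrib]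
  refine Finset.prod_congr rfl fun j _ => ?_
  rw [map_mul, Polynomial.C_ofNat]
  ring

/-- **`T_n − 1 = 2^{n−1} ∏_{j<n} (X − cos(2πj∕n))` in `ℝ[X]`** (`n ≥ 1`). [Rivlin §1.2; this file, §1274] -/
theorem chebyshevT_sub_one_eq_prod_cos_real {n : ℕ} (hn : n ≠ 0) :
    Polynomial.Chebyshev.T ℝ (n : ℤ) - 1 = Polynomial.C ((2 : ℝ) ^ (n - 1)) * ∏ j ∈ Finset.range n, (Polynomial.X - Polynomial.C (Real.cos (j * (2 * Real.pi / n)))) := by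
  apply mul_left_cancel₀ (two_ne_zero : (2 : ℝ[X]) ≠ 0)
  rw [two_mul_chebyshevT_sub_one_eq_prod_cos_real hn, ← mul_assoc, ← Polynomial.C_ofNat, ← map_mul, ← pow_succ', Nat.sub_add_cancel (Nat.one_le_iff_ne_zero.mpr hn)]

/-- **`(T_n − 1).roots = {cos(2πj∕n) : j < n}` over `ℝ`** (`n ≥ 1`, multiset — the interior alternation points occur twice). [Rivlin §1.2; this file, §1274] -/
theorem chebyshevT_sub_one_roots_real {n : ℕ} (hn : n ≠ 0) :
    (Polynomial.Chebyshev.T ℝ (n : ℤ) - 1).roots = (Multiset.range n).map fun j : ℕ => Real.cos (j * (2 * Real.pi / n)) := by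
  have h : (Multiset.range n).map (fun j : ℕ => Polynomial.X - Polynomial.C (Real.cos (j * (2 * Real.pi / n)))) =
      ((Multiset.range n).map fun j : ℕ => Real.cos (j * (2 * Real.pi / n))).map (fun a : ℝ => Polynomial.X - Polynomial.C a) := by rw [Multiset.map_map]; rfl
  rw [chebyshevT_sub_one_eq_prod_cos_real hn, roots_C_mul _ (pow_ne_zero _ two_ne_zero), Finset.prod_eq_multiset_prod, Finset.range_val, h, roots_multiset_prod_X_sub_C]

/-- **`2(T_n + 1) = 2ⁿ ∏_{j<n} (X − cos((2j+1)π∕n))` in `ℝ[X]`** (`n ≥ 1`). [Rivlin §1.2; this file, §1274] -/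
theorem two_mul_chebyshevT_add_one_eq_prod_cos_real {n : ℕ} (hn : n ≠ 0) :
    2 * (Polynomial.Chebyshev.T ℝ (n : ℤ) + 1) = Polynomial.C ((2 : ℝ) ^ n) * ∏ j ∈ Finset.range n, (Polynomial.X - Polynomial.C (Real.cos ((2 * j + 1 : ℕ) * (Real.pi / n)))) := by
  have h := congrArg (fun p : ℝ[X] => p.comp (2 * Polynomial.X)) (chebyshevC_add_two_eq_prod_cos_real hn)
  simp only [add_comp, Polynomial.Chebyshev.C_comp_two_mul_X, Polynomial.prod_comp, sub_comp, X_comp, C_comp] at h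
  rw [show (2 : ℝ[X]).comp (2 * Polynomial.X) = 2 by rw [← Polynomial.C_ofNat, C_comp], ← mul_add_one] at h
  rw [h, show (Polynomial.C ((2 : ℝ) ^ n)) = ∏ _j ∈ Finset.range n, Polynomial.C (2 : ℝ) by rw [Finset.prod_const, Finset.card_range, map_pow], ← Finset.prod_mul_distrib]
  refine Finset.prod_congr rfl fun j _ => ?_
  rw [map_mul, Polynomial.C_ofNat]
  ring

/-- **`T_n + 1 = 2^{n−1} ∏_{j<n} (X − cos((2j+1)π∕n))` in `ℝ[X]`** (`n ≥ 1`). [Rivlin §1.2; this file, §1274] -/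
theorem chebyshevT_add_one_eq_prod_cos_real {n : ℕ} (hn : n ≠ 0) :
    Polynomial.Chebyshev.T ℝ (n : ℤ) + 1 = Polynomial.C ((2 : ℝ) ^ (n - 1)) * ∏ j ∈ Finset.range n, (Polynomial.X - Polynomial.C (Real.cos ((2 * j + 1 : ℕ) * (Real.pi / n)))) := by
  apply mul_left_cancel₀ (two_ne_zero : (2 : ℝ[X]) ≠ 0)
  rw [two_mul_chebyshevT_add_one_eq_prod_cos_real hn, ← mul_assoc, ← Polynomial.C_ofNat, ← map_mul, ← pow_succ', Nat.sub_add_cancel (Nat.one_le_iff_ne_zero.mpr hn)]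

/-- **`(T_n + 1).roots = {cos((2j+1)π∕n) : j < n}` over `ℝ`** (`n ≥ 1`, multiset). [Rivlin §1.2; this file, §1274] -/
theorem chebyshevT_add_one_roots_real {n : ℕ} (hn : n ≠ 0) :
    (Polynomial.Chebyshev.T ℝ (n : ℤ) + 1).roots = (Multiset.range n).map fun j : ℕ => Real.cos ((2 * j + 1 : ℕ) * (Real.pi / n)) := by
  have h : (Multiset.range n).map (fun j : ℕ => Polynomial.X - Polynomial.C (Real.cos ((2 * j + 1 : ℕ) * (Real.pi / n)))) =
      ((Multiset.range n).map fun j : ℕ => Real.cos ((2 * j + 1 : ℕ) * (Real.pi / n))).map (fun a : ℝ => Polynomial.X - Polynomial.C a) := by rw [Multiset.map_map]; rfl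
  rw [chebyshevT_add_one_eq_prod_cos_real hn, roots_C_mul _ (pow_ne_zero _ two_ne_zero), Finset.prod_eq_multiset_prod, Finset.range_val, h, roots_multiset_prod_X_sub_C]

end Summit.Ventures.HSemireg.Wedge.HankelOuter
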